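import Literature.Topology.FourManifolds.OneOneHandlebodyModel
import Literature.Topology.FourManifolds.SPC4HandlesTwoLeaves
import Literature.Topology.FourManifolds.CorkDecomposition
import Literature.Topology.FourManifolds.DehnSurgeryUnknotZeroProofs
import Literature.Topology.FourManifolds.PropertyRTraceClosing
import Mathlib.Geometry.Manifold.Instances.Sphere
import HarnessLib

/-!
# The boundary of a compact connected orientable `4`-dimensional `(1,1)`-handlebody is `S² × S¹`

Topic `Literature/Topology/FourManifolds`; discharge of the named fact (B)
`Literature.Topology.FourManifolds.nonempty_diffeomorph_boundary_sphereTwo_prod_of_handleCount_one_one`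
of `PropertyRTraceClosing.lean` (Kirby, *The topology of 4-manifolds* (1989), Ch. I §2, p. 8:
*"`♮ᵏ S¹ × B³` (a 0-handle and k 1-handles), with boundary `#ᵏ S¹ × S²`"*, case `k = 1`;
Kosinski, *Differential Manifolds* (1993), VI (11.4)(c)): **for every compact connected orientable
smooth `4`-manifold with boundary `V` with a handle decomposition with one `0`-handle and one
`1`-handle (`HasHandleDecomposition 3 V (handleCount 1 1)`), every boundary datum `bV` has
carrier diffeomorphic to Mathlib's product manifold `↥(𝕊 2) × ↥(𝕊 1)`** (model
`(𝓡 2).prod (𝓡 1)`).  Everything here is **proved**; no named fact is introduced.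

## The argument

By UNIQ₄ (`nonempty_diffeomorph_of_hasHandleDecomposition_handleCount_one_holds`,
`SPC4HandlesTwoLeaves.lean`; Kosinski VI (11.4)(c)) any two compact connected orientable
`(1,1)`-handlebodies are diffeomorphic, and a diffeomorphism of manifolds with boundary restricts
to a diffeomorphism of any two boundary data (`BoundaryData.restrictDiffeomorph`,
`CorkDecomposition.lean`; Lee 2013, Thm. 5.11).  So one model with computed boundary suffices:
the regular sublevel set `Y = {f(x, y, z) + w² ≤ 0} ⊂ ℝ⁴` of `OneOneHandlebodyModel.lean`
(compact, connected, orientable, one `0`-handle and one `1`-handle — `≅ S¹ × B³`).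

* §3 **`∂Y = {f + w² = 0} ≅ S² × S¹` explicitly** (`OneOneHandlebodyModel.boundaryDiffeoProd`):
  `Ψ(x, y, z, w) = (σ(p), (x, y)/‖(x, y)‖)`, `σ(p) = (x² + y² - 4, 4 z, w/t)`, and
  `Φ(u, θ) = (ρ θ₀, ρ θ₁, u₁/4, u₂ t)`, `ρ = √(4 + u₀)`, are mutually inverse
  (`toProd_ofProd`, `ofProd_toProd`).  `Ψ` is smooth on the boundary manifold `∂Y` (the tree's
  `BoundaryManifold` structure on the subtype of boundary points — the carrier of
  `RegularSublevel.boundaryData`; the inclusions `∂Y ↪ Y ↪ ℝ⁴` are smooth, then Mathlib's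
  `ContMDiff.codRestrict_sphere` and the radial projection `SurgeryUnknot.circleProj` of
  `DehnSurgeryUnknotZeroProofs.lean`); `Φ` is smooth INTO `∂Y` because both inclusions are
  immersions (Mathlib's `ContMDiff.iff_comp_isImmersion`, applied twice).
* §4 `nonempty_diffeomorph_boundary_sphereTwo_prod_sphereOne_of_handleCount_one_one` (explicit
  binders) and the discharge
  `nonempty_diffeomorph_boundary_sphereTwo_prod_of_handleCount_one_one_holds`.

## References

* R. C. Kirby, *The topology of 4-manifolds*, LNM 1374 (1989), Ch. I §2, p. 8. [Kirby1989]
* A. A. Kosinski, *Differential Manifolds*, Academic Press (1993), VI (11.4)(c). [Kosinski1993]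
* J. M. Lee, *Introduction to Smooth Manifolds*, 2nd ed., GTM 218 (2013), Thm. 5.11, Cor. 5.30.
  [LeeSmoothManifolds2013]

## Design notes

* The model lives in `Type` (universe `0`), as the fact requires; UNIQ₄ is used at universe `0`.
* The maps `Ψ`, `Φ` are `def`s (unavoidable: they are the diffeomorphism); no named fact and no
  instance is introduced.
-/

open scoped Manifold ContDiff Topology
open Set Function Filter Metric Module

noncomputable section

namespace Literature.Topology.FourManifolds

/-- Local notation: `𝔼 n` is the model Euclidean space `EuclideanSpace ℝ (Fin n)`. -/
local notation "𝔼 " n:arg => EuclideanSpace ℝ (Fin n)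

/-- Local notation: `𝕊 n` is the unit sphere in `EuclideanSpace ℝ (Fin (n + 1))`. -/
local notation "𝕊 " n:arg => (Metric.sphere (0 : EuclideanSpace ℝ (Fin (n + 1))) 1)

namespace OneOneHandlebodyModel

open SolidThickening RoundSolidTorusModel SurgeryUnknot

-- Mathlib's scoped instance `Fact (finrank ℝ (EuclideanSpace ℝ (Fin n)) = n)`, feeding the
-- `[Fact (finrank ℝ E = n + 1)]` hypotheses of the sphere API (`contMDiff_coe_sphere`, ...)
open scoped EuclideanSpace

/-! ### §3 The boundary `∂Y = {F = 0}` is diffeomorphic to `S² × S¹` -/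

/-- `‖hd p‖² = x² + y²`. [folklore] -/
theorem norm_hd_sq (p : 𝔼 4) : ‖hd p‖ ^ 2 = p 0 ^ 2 + p 1 ^ 2 := by
  rw [EuclideanSpace.norm_sq_eq, Fin.sum_univ_two]
  simp [Real.norm_eq_abs, sq_abs]

/-- On the level `{F = 0}`: `(x, y) ≠ 0`. [folklore] -/
theorem hd_ne_zero_of_F_eq_zero {p : 𝔼 4} (hp : F p = 0) : hd p ≠ 0 := by
  intro h0
  have h := three_le_of_F_eq_zero hp
  rw [← norm_hd_sq, h0, norm_zero] at h
  norm_num at h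

/-- The boundary `∂Y` of the model, as a type (the subtype of boundary points, with the smooth
structure `BoundaryManifold.chartedSpace` of the tree; it is the carrier of the boundary datum
`RegularSublevel.boundaryData isRegularLevel_F`). [folklore] -/
abbrev BdY : Type := ↥((𝓡∂ 4).boundary Y)

/-- The coordinates in `ℝ⁴` of a boundary point. [folklore] -/
def pt (z : BdY) : 𝔼 4 := RegularSublevel.incl isRegularLevel_F z.1

/-- Boundary points lie on the level `{F = 0}`. [folklore] -/
theorem F_pt (z : BdY) : F (pt z) = 0 := (RegularSublevel.mem_boundary_iff _ z.1).1 z.2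

/-- `∂Y → ℝ⁴` is smooth (composition of the two smooth inclusions `∂Y ↪ Y ↪ ℝ⁴`). [folklore] -/
theorem contMDiff_pt : ContMDiff (𝓡 3) (𝓡 4) ∞ pt :=
  (RegularSublevel.contMDiff_incl isRegularLevel_F).comp
    (BoundaryManifold.isSmoothEmbedding_subtype_val (n := 3) (W := Y)).contMDiff

/-- `∂Y → ℝ⁴` is continuous. [folklore] -/
theorem continuous_pt : Continuous pt := contMDiff_pt.continuous

/-- `∂Y → ℝ⁴` is injective. [folklore] -/
theorem pt_injective : Injective pt := fun _ _ h =>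
  Subtype.ext (RegularSublevel.injective_incl isRegularLevel_F h)

/-- The `S²`-coordinate of a boundary point: `σ(p) ∈ S²`. [folklore] -/
def sph : BdY → 𝕊 2 :=
  Set.codRestrict (fun z => sig (pt z)) _ fun z => by
    rw [mem_sphere_zero_iff_norm]; exact norm_sig_eq_one (F_pt z)

/-- The `S²`-coordinate, in `ℝ³`. [folklore] -/
@[simp] theorem coe_sph (z : BdY) : (sph z : 𝔼 3) = sig (pt z) := rfl

/-- The `S²`-coordinate is smooth. [folklore] -/
theorem contMDiff_sph : ContMDiff (𝓡 3) (𝓡 2) ∞ sph :=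
  (contDiff_sig.comp_contMDiff contMDiff_pt).codRestrict_sphere _

/-- The `S¹`-coordinate of a boundary point: `(x, y) / ‖(x, y)‖`. [folklore] -/
def cir (z : BdY) : 𝕊 1 := circleProj (hd (pt z))

/-- The `S¹`-coordinate is smooth (`(x, y) ≠ 0` on the level). [folklore] -/
theorem contMDiff_cir : ContMDiff (𝓡 3) (𝓡 1) ∞ cir :=
  contMDiffOn_circleProj.comp_contMDiff (contDiff_hd.comp_contMDiff contMDiff_pt) fun z =>
    hd_ne_zero_of_F_eq_zero (F_pt z)

/-- **The coordinate map `∂Y → S² × S¹`.** [folklore] -/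
def toProd (z : BdY) : (𝕊 2) × (𝕊 1) := (sph z, cir z)

/-- `∂Y → S² × S¹` is smooth. [folklore] -/
theorem contMDiff_toProd : ContMDiff (𝓡 3) ((𝓡 2).prod (𝓡 1)) ∞ toProd :=
  contMDiff_sph.prodMk contMDiff_cir

/-! #### The parametrisation `S² × S¹ → ∂Y` -/

/-- For `u ∈ S²`: `0 < 4 + u₀`. [folklore] -/
theorem four_add_pos (u : 𝕊 2) : 0 < 4 + (u : 𝔼 3) 0 := by
  nlinarith [sphereTwo_coord_sq u, sq_nonneg ((u : 𝔼 3) 1), sq_nonneg ((u : 𝔼 3) 2),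
    sq_nonneg ((u : 𝔼 3) 0 + 1)]

/-- For `u ∈ S²`: `ρ(u)² = 4 + u₀`. [folklore] -/
theorem rho_sq (u : 𝕊 2) : rho (u : 𝔼 3) ^ 2 = 4 + (u : 𝔼 3) 0 :=
  Real.sq_sqrt (four_add_pos u).le

/-- For `u ∈ S²`: `0 < ρ(u)`. [folklore] -/
theorem rho_pos (u : 𝕊 2) : 0 < rho (u : 𝔼 3) := Real.sqrt_pos.2 (four_add_pos u)

/-- **`Φ` maps `S² × S¹` into the level `{F = 0}`**: with `x² + y² = ρ² = 4 + u₀`,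
`G = u₀² + u₁² - 1 = -u₂²`, `E = t²` and `w² = u₂² t²`. [folklore] -/
theorem F_phi (q : (𝕊 2) × (𝕊 1)) : F (phi ((q.1 : 𝔼 3), (q.2 : 𝔼 2))) = 0 := by
  obtain ⟨u, θ⟩ := q
  have hu := sphereTwo_coord_sq u
  have hθ := GluckUnknot.sq_add_sq_of_norm_eq_one (norm_eq_of_mem_sphere θ)
  have hρ := rho_sq u
  have hE : E (proj₃ (phi ((u : 𝔼 3), (θ : 𝔼 2)))) =
      tilt (rho u * (θ : 𝔼 2) 0) (rho u * (θ : 𝔼 2) 1) ^ 2 := by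
    rw [← tilt_sq]; rfl
  have hG : G (proj₃ (phi ((u : 𝔼 3), (θ : 𝔼 2)))) = -((u : 𝔼 3) 2 ^ 2) := by
    simp only [G, proj₃_apply_zero, proj₃_apply_one, proj₃_apply_two, phi_apply_zero,
      phi_apply_one, phi_apply_two]
    have h1 : (rho u * (θ : 𝔼 2) 0) ^ 2 + (rho u * (θ : 𝔼 2) 1) ^ 2 = 4 + (u : 𝔼 3) 0 := by
      rw [← hρ]; linear_combination rho (u : 𝔼 3) ^ 2 * hθ
    rw [h1]
    linear_combination hu
  rw [F, thicken₄_apply, fn, hG, hE, phi_apply_three]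
  ring

/-- The parametrisation with values in `Y`. [folklore] -/
def ofProdY (q : (𝕊 2) × (𝕊 1)) : Y :=
  RegularSublevel.mk isRegularLevel_F (phi ((q.1 : 𝔼 3), (q.2 : 𝔼 2))) (F_phi q).le

/-- **The parametrisation `Φ : S² × S¹ → ∂Y`.** [folklore] -/
def ofProd (q : (𝕊 2) × (𝕊 1)) : BdY :=
  ⟨ofProdY q, (RegularSublevel.mem_boundary_iff _ _).2 (F_phi q)⟩

/-- `Φ` in coordinates. [folklore] -/
@[simp] theorem pt_ofProd (q : (𝕊 2) × (𝕊 1)) : pt (ofProd q) = phi ((q.1 : 𝔼 3), (q.2 : 𝔼 2)) :=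
  rfl

/-- The pair of ambient coordinates `S² × S¹ → ℝ³ × ℝ²` is smooth. [folklore] -/
theorem contMDiff_coe_prod :
    ContMDiff ((𝓡 2).prod (𝓡 1)) 𝓘(ℝ, 𝔼 3 × 𝔼 2) ∞
      (fun q : (𝕊 2) × (𝕊 1) => ((q.1 : 𝔼 3), (q.2 : 𝔼 2))) :=
  ((contMDiff_coe_sphere (n := 2)).comp contMDiff_fst).prodMk_space
    ((contMDiff_coe_sphere (n := 1)).comp contMDiff_snd)

/-- `Φ : S² × S¹ → ℝ⁴` is smooth. [folklore] -/
theorem contMDiff_phi_coe :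
    ContMDiff ((𝓡 2).prod (𝓡 1)) (𝓡 4) ∞
      (fun q : (𝕊 2) × (𝕊 1) => phi ((q.1 : 𝔼 3), (q.2 : 𝔼 2))) := fun q =>
  (contDiffAt_phi (four_add_pos q.1).ne').comp_contMDiffAt (contMDiff_coe_prod q)

/-- `Φ : S² × S¹ → Y` is smooth (smooth into `ℝ⁴` and continuous into `Y`, whose inclusion is
an immersion; Mathlib's `ContMDiff.iff_comp_isImmersion`). [folklore] -/
theorem contMDiff_ofProdY : ContMDiff ((𝓡 2).prod (𝓡 1)) (𝓡∂ 4) ∞ ofProdY := by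
  rw [ContMDiff.iff_comp_isImmersion (RegularSublevel.isSmoothEmbedding_incl isRegularLevel_F).isImmersion]
  refine ⟨?_, contMDiff_phi_coe⟩
  rw [(RegularSublevel.isEmbedding_incl isRegularLevel_F).continuous_iff]
  exact contMDiff_phi_coe.continuous

/-- **`Φ : S² × S¹ → ∂Y` is smooth** (the inclusion `∂Y ↪ Y` is an immersion). [folklore] -/
theorem contMDiff_ofProd : ContMDiff ((𝓡 2).prod (𝓡 1)) (𝓡 3) ∞ ofProd := by
  rw [ContMDiff.iff_comp_isImmersion
    (BoundaryManifold.isSmoothEmbedding_subtype_val (n := 3) (W := Y)).isImmersion]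
  exact ⟨contMDiff_ofProdY.continuous.subtype_mk _, contMDiff_ofProdY⟩

/-! #### The two maps are mutually inverse -/

/-- `(x, y)` of `Φ(u, θ)` is `ρ θ`. [folklore] -/
theorem hd_phi (u : 𝔼 3) (θ : 𝔼 2) : hd (phi (u, θ)) = rho u • θ := by
  ext i
  fin_cases i <;> simp [hd]

/-- `Ψ ∘ Φ = id`. [folklore] -/
theorem toProd_ofProd (q : (𝕊 2) × (𝕊 1)) : toProd (ofProd q) = q := by
  obtain ⟨u, θ⟩ := q
  have hθ := GluckUnknot.sq_add_sq_of_norm_eq_one (norm_eq_of_mem_sphere θ)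
  have hρ := rho_sq u
  refine Prod.ext (Subtype.ext ?_) ?_
  · -- the sphere coordinate
    show sig (phi ((u : 𝔼 3), (θ : 𝔼 2))) = (u : 𝔼 3)
    ext i
    fin_cases i
    · show (rho u * (θ : 𝔼 2) 0) ^ 2 + (rho u * (θ : 𝔼 2) 1) ^ 2 - 4 = (u : 𝔼 3) 0
      linear_combination rho (u : 𝔼 3) ^ 2 * hθ + hρ
    · show 4 * ((u : 𝔼 3) 1 / 4) = (u : 𝔼 3) 1
      ring
    · show (u : 𝔼 3) 2 * tilt (rho u * (θ : 𝔼 2) 0) (rho u * (θ : 𝔼 2) 1) *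
          Real.exp (-(rho u * (θ : 𝔼 2) 0 * (12 - (rho u * (θ : 𝔼 2) 0) ^ 2 -
            (rho u * (θ : 𝔼 2) 1) ^ 2)) / 128) = (u : 𝔼 3) 2
      rw [mul_assoc, tilt_mul_exp_neg, mul_one]
  · -- the circle coordinate
    show circleProj (hd (phi ((u : 𝔼 3), (θ : 𝔼 2)))) = θ
    rw [hd_phi, circleProj_smul_coe (rho_pos u)]

/-- `Φ ∘ Ψ = id`. [folklore] -/
theorem ofProd_toProd (z : BdY) : ofProd (toProd z) = z := by
  apply pt_injective
  rw [pt_ofProd]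
  set p := pt z with hp
  have hF : F p = 0 := F_pt z
  have hhd : hd p ≠ 0 := hd_ne_zero_of_F_eq_zero hF
  -- `ρ(σ(p)) = ‖(x, y)‖`
  have hρ : rho (sig p) = ‖hd p‖ := by
    rw [rho, sig_apply_zero, ← norm_hd_sq]
    simp [Real.sqrt_sq (norm_nonneg _)]
  -- the first two coordinates
  have h01 : ∀ i : Fin 2, rho (sig p) * (circleProj (hd p) : 𝔼 2) i = hd p i := fun i => by
    rw [hρ]
    have := congrArg (fun v : 𝔼 2 => v i) (norm_smul_coe_circleProj hhd)
    simpa [smul_eq_mul] using this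
  have h0 : rho (sig p) * (circleProj (hd p) : 𝔼 2) 0 = p 0 := h01 0
  have h1 : rho (sig p) * (circleProj (hd p) : 𝔼 2) 1 = p 1 := h01 1
  ext i
  fin_cases i
  · exact h0
  · exact h1
  · show sig p 1 / 4 = p 2
    rw [sig_apply_one]; ring
  · show sig p 2 * tilt (rho (sig p) * (circleProj (hd p) : 𝔼 2) 0)
      (rho (sig p) * (circleProj (hd p) : 𝔼 2) 1) = p 3
    rw [h0, h1, sig_apply_two, mul_assoc, mul_comm (Real.exp _), tilt_mul_exp_neg, mul_one]

/-- **The boundary of the model `(1,1)`-handlebody is diffeomorphic to `S² × S¹`**: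
`∂Y = {f(x, y, z) + w² = 0} ≅ S² × S¹` by `Ψ = (σ, (x, y)/‖(x, y)‖)` and `Φ`. [folklore] -/
def boundaryDiffeoProd : BdY ≃ₘ⟮𝓡 3, (𝓡 2).prod (𝓡 1)⟯ ((𝕊 2) × (𝕊 1)) where
  toFun := toProd
  invFun := ofProd
  left_inv := ofProd_toProd
  right_inv := toProd_ofProd
  contMDiff_toFun := contMDiff_toProd
  contMDiff_invFun := contMDiff_ofProd

end OneOneHandlebodyModel

/-! ### §4 The boundary of every compact connected orientable `(1,1)`-handlebody -/

/-- **The boundary of a compact connected orientable `4`-dimensional `(1,1)`-handlebody is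
diffeomorphic to `S² × S¹`.**  Kirby, *The topology of 4-manifolds* (1989), Ch. I §2, p. 8:
*"`♮ᵏ S¹ × B³` (a 0-handle and k 1-handles), with boundary `#ᵏ S¹ × S²`"*, case `k = 1`;
Kosinski, *Differential Manifolds* (1993), VI (11.4)(c) (genus and orientability classify
`(m, 1)`-handlebodies).  Proof: by UNIQ₄
(`nonempty_diffeomorph_of_hasHandleDecomposition_handleCount_one_holds`) `V` is diffeomorphic to
the model `Y = {f(x, y, z) + w² ≤ 0} ⊂ ℝ⁴` (`OneOneHandlebodyModel.Y`: compact, connected,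
orientable, one `0`-handle and one `1`-handle); a diffeomorphism restricts to the boundary data
(`BoundaryData.restrictDiffeomorph`), and `∂Y ≅ S² × S¹` explicitly
(`OneOneHandlebodyModel.boundaryDiffeoProd`). [cite: Kirby1989, Ch. I §2, p. 8] -/
theorem nonempty_diffeomorph_boundary_sphereTwo_prod_sphereOne_of_handleCount_one_one
    (V : Type) [TopologicalSpace V] [T2Space V] [SecondCountableTopology V]
    [ChartedSpace (EuclideanHalfSpace 4) V] [IsManifold (𝓡∂ 4) ∞ V] [CompactSpace V]
    [ConnectedSpace V] (hV : HasHandleDecomposition 3 V (handleCount 1 1))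
    (ho : IsOrientable (𝓡∂ 4) V) (bV : BoundaryData (𝓡∂ 4) V (𝓡 3)) :
    Nonempty (bV.carrier ≃ₘ⟮𝓡 3, (𝓡 2).prod (𝓡 1)⟯ ((𝕊 2) × (𝕊 1))) := by
  obtain ⟨Ψ⟩ := nonempty_diffeomorph_of_hasHandleDecomposition_handleCount_one_holds 1 V
    OneOneHandlebodyModel.Y hV ho OneOneHandlebodyModel.hasHandleDecomposition_Y
    OneOneHandlebodyModel.isOrientable_Y
  exact ⟨(bV.restrictDiffeomorph (RegularSublevel.boundaryData OneOneHandlebodyModel.isRegularLevel_F)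
    Ψ).trans OneOneHandlebodyModel.boundaryDiffeoProd⟩

/-- **Discharge of the named fact
`Literature.Topology.FourManifolds.nonempty_diffeomorph_boundary_sphereTwo_prod_of_handleCount_one_one`**
(`PropertyRTraceClosing.lean`, fact (B): the boundary of a compact connected orientable
`(1,1)`-handlebody is Mathlib's product `S² × S¹`; Kirby (1989), Ch. I §2, p. 8, `k = 1`;
Kosinski (1993), VI (11.4)(c)). [cite: Kirby1989, Ch. I §2, p. 8] -/
theorem nonempty_diffeomorph_boundary_sphereTwo_prod_of_handleCount_one_one_holds :
    nonempty_diffeomorph_boundary_sphereTwo_prod_of_handleCount_one_one :=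
  fun V _ _ _ _ _ _ _ hV ho bV =>
    nonempty_diffeomorph_boundary_sphereTwo_prod_sphereOne_of_handleCount_one_one V hV ho bV

end Literature.Topology.FourManifolds
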